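import Literature.AlgebraicGeometry.ModuliOfAbelianVarieties.SiegelModuliComplexUniformisation
import Literature.AlgebraicGeometry.Motives.ComplexPointsSubmersion
import Literature.Analysis.Complex.InjectiveHolomorphic
import Literature.NumberTheory.ModularForms.SiegelSymplecticVolume
import HarnessLib

/-!
# Local inverses of injective holomorphic period maps: the analytic clauses of the Siegel classifying map

K. Fritzsche, H. Grauert, *From Holomorphic Functions to Complex Manifolds* (2002), Ch. I §8 Thm. 8.5 / Cor. 8.6
(Clements–Osgood: an injective holomorphic map between domains of the same dimension is open with holomorphic
inverse); H. Klingen, *Introductory lectures on Siegel modular forms* (1990), Ch. I §1 Def. 2 (`𝔥_g` as an open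
subset of `ℂ^{g(g+1)/2}` through the coordinates `z_{kl}`, `k ≤ l`); J.-P. Serre, GAGA §2 n° 5 Prop. 2 (regular
functions are holomorphic in algebraic charts).

Let `Y` be a `ℂ`-scheme, locally of finite type and smooth of relative dimension `g(g+1)/2`, and
`f : M_g(ℂ) → Y(ℂ)` a function.  Suppose that around every `Z₀ ∈ 𝔥_g` there are an open `W ⊆ Y(ℂ)` and a map
`π : Y(ℂ) → M_g(ℂ)`, continuous and injective on `W`, entrywise holomorphic on `W` in the holomorphic algebraic charts
`ComplexPoints.algebraicChart Y (g(g+1)/2) x` (`x ∈ W`), with `π(W) ⊆ 𝔥_g`, `Z₀ ∈ π(W)` and `f (π x) = x` on `W` —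
i.e. `f` is, near every point of `𝔥_g`, a set-theoretic inverse of an injective holomorphic "period map" IN EQUAL
DIMENSION.  Then (`continuousOn_isOpenMap_differentiableOn_of_localInverse`):

* `f` is continuous on `𝔥_g`;
* `f` restricted to `𝔥_g` is an open map;
* `f` is holomorphic in affine algebraic coordinates: for every affine open `U ⊆ Y` and `s ∈ Γ(Y, U)`,
  `Z ↦ s(f Z)` is complex-differentiable on `𝔥_g ∩ f⁻¹ U(ℂ)`

— the three analytic clauses of the tree's `SiegelModuliDatum` (:489 / :491 / :502).  Proof: in the chart
`e = algebraicChart Y (g(g+1)/2) x₁` at a point `x₁ ∈ W` over `Z₀` and in Klingen's coordinates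
`κ : M_g(ℂ) → ℂ^{g(g+1)/2}` (symmetrised, `κ Z {k,l} = (Z_{kl} + Z_{lk})/2`, a linear map injective on symmetric
matrices) the map `G = κ ∘ π ∘ e⁻¹` is injective and holomorphic between open subsets of `ℂ^{g(g+1)/2}`; by
Clements–Osgood its image is open and its inverse holomorphic, so that near `Z₀` the function `f` agrees on `𝔥_g` with
the map `h = e⁻¹ ∘ G⁻¹ ∘ κ`, defined, continuous, open along `𝔥_g` and holomorphic in algebraic coordinates on an open
subset of `M_g(ℂ)`.

The specialisation `siegelClassifyingMap_clauses_of_localInverse` to `Y := 𝓜.M ⊗_ℚ ℂ` for a Siegel fine moduli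
scheme `𝓜` is, binder for binder, the socket «U-e P5» of the cell hodgecm-mathlib's (U)-head (the one place where the
equidimensionality hypothesis `dim 𝓜_ℂ = g(g+1)/2` enters the complex-uniformisation road).  Everything here is proved;
no definitions, no named facts.

## References

* [FritzscheGrauert2002] K. Fritzsche, H. Grauert, From Holomorphic Functions to Complex Manifolds, GTM 213 (2002),
  Ch. I §8 Thm. 8.5, Cor. 8.6.
* [Klingen1990] H. Klingen, Introductory lectures on Siegel modular forms (1990), Ch. I §1 Def. 2 (p. 2).
* [SerreGAGA1956] J.-P. Serre, Géométrie algébrique et géométrie analytique, Ann. Inst. Fourier 6 (1956), §2 n° 5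
  Prop. 2.
* [MumfordFogartyKirwan1994] D. Mumford, J. Fogarty, F. Kirwan, Geometric Invariant Theory (3rd ed.), Appendix to
  Ch. 7 §A (pp. 234–235).
-/

set_option autoImplicit false

noncomputable section

open Set Function Filter Topology CategoryTheory AlgebraicGeometry Matrix
open scoped Matrix.Norms.Elementwise
open Literature.AlgebraicGeometry.Motives (SchemeOver ComplexPoints AlgPoints specOver)
open Literature.AlgebraicGeometry.Motives.AlgPoints (evalOrZero)
open Literature.AlgebraicGeometry.Motives.ComplexPoints (algebraicChart mem_algebraicChart_source algebraicChart_spec)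
open Literature.NumberTheory.Automorphic (siegelUpperHalfSpace mem_siegelUpperHalfSpace_iff)
open Literature.NumberTheory.ModularForms.SiegelUpperHalfSpace (coordCLE siegelUpperHalfSpaceCoord
  mem_siegelUpperHalfSpaceCoord_iff isOpen_siegelUpperHalfSpaceCoord coe_coordCLE_symm_apply coordCLE_apply_mk)
open Literature.LinearAlgebra.Matrix (symmetricSubmodule mem_symmetricSubmodule isSymm_coe)

namespace Literature.AlgebraicGeometry.ModuliOfAbelianVarieties

namespace SiegelLocalInverse

variable {g : ℕ}

/-! ### Klingen's symmetrised coordinates `κ : M_g(ℂ) → ℂ^{g(g+1)/2}` -/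

/-- The symmetrised Klingen coordinate map `Z ↦ ({k,l} ↦ (Z_{kl} + Z_{lk})/2)` is `ℂ`-linear and continuous; we
record its existence with the two properties used below (it inverts `coordCLE` on symmetric matrices, so it is
injective on them and carries `𝔥_g` onto Klingen's open coordinate set). [cite: Klingen1990, Ch. I §1 Def. 2 (p. 2)] -/
theorem exists_symCoord (g : ℕ) :
    ∃ κ : Matrix (Fin g) (Fin g) ℂ →L[ℂ] (Sym2 (Fin g) → ℂ),
      ∀ Z : Matrix (Fin g) (Fin g) ℂ, Z.IsSymm →
        (((coordCLE g).symm (κ Z) : symmetricSubmodule (Fin g) ℂ) : Matrix (Fin g) (Fin g) ℂ) = Z := by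
  classical
  let L : Matrix (Fin g) (Fin g) ℂ →ₗ[ℂ] (Sym2 (Fin g) → ℂ) :=
    { toFun := fun Z s ↦ Sym2.lift ⟨fun i k ↦ (Z i k + Z k i) / 2, fun i k ↦ by ring⟩ s
      map_add' := fun Z Z' ↦ by
        funext s
        induction s using Sym2.ind with
        | h i k => simp only [Sym2.lift_mk, Matrix.add_apply, Pi.add_apply]; ring
      map_smul' := fun c Z ↦ by
        funext s
        induction s using Sym2.ind with
        | h i k => simp only [Sym2.lift_mk, Matrix.smul_apply, Pi.smul_apply, smul_eq_mul, RingHom.id_apply]; ring }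
  refine ⟨LinearMap.toContinuousLinearMap L, fun Z hZ ↦ ?_⟩
  ext i k
  rw [LinearMap.coe_toContinuousLinearMap', coe_coordCLE_symm_apply]
  change Sym2.lift ⟨fun i k ↦ (Z i k + Z k i) / 2, _⟩ s(i, k) = Z i k
  have : Z k i = Z i k := hZ.apply i k
  simp only [Sym2.lift_mk, this]
  ring

/-- `dim_ℂ ℂ^{g(g+1)/2}`: `finrank ℂ (Sym2 (Fin g) → ℂ) = g(g+1)/2`. [cite: Klingen1990, Ch. I §1 Def. 2 (p. 2)] -/
theorem finrank_sym2_fun (g : ℕ) : Module.finrank ℂ (Sym2 (Fin g) → ℂ) = g * (g + 1) / 2 := by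
  rw [Module.finrank_fintype_fun_eq_card, Sym2.card, Fintype.card_fin, Nat.choose_two_right, Nat.add_sub_cancel,
    mul_comm]

/-! ### The local factorisation `f = e⁻¹ ∘ G⁻¹ ∘ κ` near a point of `𝔥_g` -/

variable (Y : SchemeOver ℂ) [LocallyOfFiniteType Y.hom] [SmoothOfRelativeDimension (g * (g + 1) / 2) Y.hom]
  (f : Matrix (Fin g) (Fin g) ℂ → ComplexPoints Y)

/-- **Local structure of a set-theoretic inverse of an injective holomorphic period map (Clements–Osgood).** Under the
local-inverse hypothesis at `Z₀ ∈ 𝔥_g` (an open `W ⊆ Y(ℂ)` and `π : Y(ℂ) → M_g(ℂ)` continuous, injective and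
chart-holomorphic on `W`, `π(W) ⊆ 𝔥_g`, `Z₀ ∈ π(W)`, `f ∘ π = id` on `W`), there are an open `O ∋ Z₀` of `M_g(ℂ)` and
a map `h : M_g(ℂ) → Y(ℂ)`, continuous on `O` and holomorphic on `O` in affine algebraic coordinates, which agrees with `f`
on `𝔥_g ∩ O` and maps the relatively open subsets of `𝔥_g ∩ O` to open subsets of `Y(ℂ)`.  (`h = e⁻¹ ∘ G⁻¹ ∘ κ` with
`G = κ ∘ π ∘ e⁻¹` injective holomorphic between opens of `ℂ^{g(g+1)/2}`, open with holomorphic inverse by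
Fritzsche–Grauert Thm. 8.5 / Cor. 8.6.) [cite: FritzscheGrauert2002, Ch. I §8 Thm. 8.5 and Cor. 8.6]
[cite: SerreGAGA1956, §2 n°5 Prop. 2] -/
theorem exists_local_extension {Z₀ : Matrix (Fin g) (Fin g) ℂ}
    (H : ∃ (W : Set (ComplexPoints Y)) (π : ComplexPoints Y → Matrix (Fin g) (Fin g) ℂ),
      IsOpen W ∧ Z₀ ∈ π '' W ∧ π '' W ⊆ siegelUpperHalfSpace g ∧ InjOn π W ∧ ContinuousOn π W ∧
      (∀ x ∈ W, ∀ (i j : Fin g),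
        DifferentiableOn ℂ ((fun y ↦ π y i j) ∘ (algebraicChart Y (g * (g + 1) / 2) x).symm)
          ((algebraicChart Y (g * (g + 1) / 2) x).target ∩ (algebraicChart Y (g * (g + 1) / 2) x).symm ⁻¹' W)) ∧
      (∀ x ∈ W, f (π x) = x)) :
    ∃ (O : Set (Matrix (Fin g) (Fin g) ℂ)) (h : Matrix (Fin g) (Fin g) ℂ → ComplexPoints Y),
      IsOpen O ∧ Z₀ ∈ O ∧ ContinuousOn h O ∧
      (∀ (U : Y.left.affineOpens) (s : Y.left.presheaf.obj (Opposite.op (↑U : Y.left.Opens))),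
        DifferentiableOn ℂ (fun Z ↦ evalOrZero (↑U : Y.left.Opens) s (h Z)) (O ∩ h ⁻¹' {P | P.pt ∈ (↑U : Y.left.Opens)})) ∧
      (∀ Z ∈ siegelUpperHalfSpace g, Z ∈ O → f Z = h Z) ∧
      (∀ B : Set (Matrix (Fin g) (Fin g) ℂ), IsOpen B → IsOpen (f '' (siegelUpperHalfSpace g ∩ O ∩ B))) := by
  classical
  obtain ⟨W, π, hW, ⟨x₁, hx₁W, hπx₁⟩, hπH, hinj, hcont, hhol, hfπ⟩ := H
  obtain ⟨κ, hκ⟩ := exists_symCoord g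
  set n : ℕ := g * (g + 1) / 2 with hn
  -- symmetric matrices: `κ` is injective on them, and `κ(𝔥_g)` is Klingen's open coordinate set
  have hsymH : ∀ Z ∈ siegelUpperHalfSpace g, Z.IsSymm := fun Z hZ ↦ ((mem_siegelUpperHalfSpace_iff).1 hZ).1
  have hκinj : ∀ Z Z' : Matrix (Fin g) (Fin g) ℂ, Z.IsSymm → Z'.IsSymm → κ Z = κ Z' → Z = Z' := by
    intro Z Z' hZ hZ' h
    rw [← hκ Z hZ, ← hκ Z' hZ', h]
  have hκmem : ∀ Z ∈ siegelUpperHalfSpace g, κ Z ∈ siegelUpperHalfSpaceCoord g := fun Z hZ ↦ by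
    rw [mem_siegelUpperHalfSpaceCoord_iff, hκ Z (hsymH Z hZ)]; exact hZ
  have hκopen : ∀ B : Set (Matrix (Fin g) (Fin g) ℂ), IsOpen B →
      IsOpen (κ '' (siegelUpperHalfSpace g ∩ B)) := by
    intro B hB
    have heq : κ '' (siegelUpperHalfSpace g ∩ B) = siegelUpperHalfSpaceCoord g ∩
        (fun v : Sym2 (Fin g) → ℂ ↦ (((coordCLE g).symm v : symmetricSubmodule (Fin g) ℂ) :
          Matrix (Fin g) (Fin g) ℂ)) ⁻¹' B := by
      ext v
      constructor
      · rintro ⟨Z, ⟨hZH, hZB⟩, rfl⟩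
        refine ⟨hκmem Z hZH, ?_⟩
        show (((coordCLE g).symm (κ Z) : symmetricSubmodule (Fin g) ℂ) : Matrix (Fin g) (Fin g) ℂ) ∈ B
        rw [hκ Z (hsymH Z hZH)]; exact hZB
      · rintro ⟨hvH, hvB⟩
        refine ⟨_, ⟨(mem_siegelUpperHalfSpaceCoord_iff).1 hvH, hvB⟩, ?_⟩
        have h1 := hκ _ (isSymm_coe ((coordCLE g).symm v))
        have h2 : (coordCLE g).symm (κ (((coordCLE g).symm v : symmetricSubmodule (Fin g) ℂ) :
            Matrix (Fin g) (Fin g) ℂ)) = (coordCLE g).symm v := Subtype.ext h1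
        simpa using congrArg (coordCLE g) h2
    rw [heq]
    exact isOpen_siegelUpperHalfSpaceCoord.inter
      (hB.preimage (continuous_subtype_val.comp (coordCLE g).symm.continuous))
  -- the chart at `x₁` and the injective holomorphic map `G = κ ∘ π ∘ e⁻¹`
  set e := algebraicChart Y n x₁ with he
  have hx₁e : x₁ ∈ e.source := mem_algebraicChart_source Y n x₁
  set V : Set (ComplexPoints Y) := W ∩ e.source with hV
  have hVo : IsOpen V := hW.inter e.open_source
  have hVW : V ⊆ W := inter_subset_left
  set O' : Set (Fin n → ℂ) := e.target ∩ e.symm ⁻¹' V with hO'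
  have hO'o : IsOpen O' := e.isOpen_inter_preimage_symm hVo
  have hO'W : ∀ u ∈ O', e.symm u ∈ W := fun u hu ↦ hVW hu.2
  set G : (Fin n → ℂ) → (Sym2 (Fin g) → ℂ) := fun u ↦ κ (π (e.symm u)) with hG
  have hπe : DifferentiableOn ℂ (fun u ↦ π (e.symm u)) O' := by
    refine differentiableOn_pi.2 fun i ↦ differentiableOn_pi.2 fun j ↦ ?_
    exact (hhol x₁ hx₁W i j).mono fun u hu ↦ ⟨hu.1, hO'W u hu⟩
  have hGd : DifferentiableOn ℂ G O' := κ.differentiable.comp_differentiableOn hπe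
  have hGinj : InjOn G O' := by
    intro u hu u' hu' huu'
    have hsu : (π (e.symm u)).IsSymm := hsymH _ (hπH ⟨_, hO'W u hu, rfl⟩)
    have hsu' : (π (e.symm u')).IsSymm := hsymH _ (hπH ⟨_, hO'W u' hu', rfl⟩)
    have h1 : π (e.symm u) = π (e.symm u') := hκinj _ _ hsu hsu' huu'
    have h2 : e.symm u = e.symm u' := hinj (hO'W u hu) (hO'W u' hu') h1
    exact e.symm.injOn hu.1 hu'.1 h2
  have hGc : ContinuousOn G O' :=
    κ.continuous.comp_continuousOn
      ((hcont.mono hVW).comp (e.continuousOn_symm.mono inter_subset_left) fun u hu ↦ hu.2)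
  have hdim : Module.finrank ℂ (Fin n → ℂ) = Module.finrank ℂ (Sym2 (Fin g) → ℂ) := by
    rw [finrank_sym2_fun, Module.finrank_fintype_fun_eq_card, Fintype.card_fin]
  -- Clements–Osgood: `G : O' → G(O')` is an open partial homeomorphism with holomorphic inverse
  set eG : PartialEquiv (Fin n → ℂ) (Sym2 (Fin g) → ℂ) := hGinj.toPartialEquiv G O' with heG
  have hopen : IsOpenMap (O'.restrict G) := by
    intro S hS
    obtain ⟨B, hB, rfl⟩ := isOpen_induced_iff.1 hS
    have himg : O'.restrict G '' (Subtype.val ⁻¹' B) = G '' (O' ∩ B) := by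
      ext y
      constructor
      · rintro ⟨⟨w, hwO⟩, hwB, rfl⟩
        exact ⟨w, ⟨hwO, hwB⟩, rfl⟩
      · rintro ⟨w, ⟨hwO, hwB⟩, rfl⟩
        exact ⟨⟨w, hwO⟩, hwB, rfl⟩
    rw [himg]
    exact Literature.Analysis.Complex.SCV.isOpen_image_of_injOn hdim (hGd.mono inter_subset_left)
      (hO'o.inter hB) (hGinj.mono inter_subset_left)
  set T : OpenPartialHomeomorph (Fin n → ℂ) (Sym2 (Fin g) → ℂ) :=
    OpenPartialHomeomorph.ofContinuousOpenRestrict eG hGd.continuousOn hopen hO'o with hT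
  have hTsrc : T.source = O' := rfl
  have hTtgt : T.target = G '' O' := rfl
  have hTapply : ∀ u, T u = G u := fun u ↦ rfl
  have hTsymm : DifferentiableOn ℂ T.symm T.target :=
    Literature.Analysis.Complex.SCV.differentiableOn_symm_of_differentiableOn hdim T hGd
  have hTsrc_e : ∀ v ∈ T.target, T.symm v ∈ e.target := fun v hv ↦ by
    have : T.symm v ∈ T.source := T.map_target hv
    rw [hTsrc] at this; exact this.1
  -- the open set `O = κ⁻¹ (G(O'))` and the extension `h = e⁻¹ ∘ G⁻¹ ∘ κ`
  set O : Set (Matrix (Fin g) (Fin g) ℂ) := κ ⁻¹' T.target with hO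
  set h : Matrix (Fin g) (Fin g) ℂ → ComplexPoints Y := fun Z ↦ e.symm (T.symm (κ Z)) with hh
  have hOo : IsOpen O := T.open_target.preimage κ.continuous
  have hex₁O' : e x₁ ∈ O' := ⟨e.map_source hx₁e, by
    show e.symm (e x₁) ∈ V; rw [e.left_inv hx₁e]; exact ⟨hx₁W, hx₁e⟩⟩
  have hZ₀O : Z₀ ∈ O := by
    show κ Z₀ ∈ T.target
    rw [hTtgt]
    refine ⟨e x₁, hex₁O', ?_⟩
    show κ (π (e.symm (e x₁))) = κ Z₀
    rw [e.left_inv hx₁e, hπx₁]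
  have hfh : ∀ Z ∈ siegelUpperHalfSpace g, Z ∈ O → f Z = h Z := by
    intro Z hZ hZO
    have hZT : κ Z ∈ T.target := hZO
    obtain ⟨u, hu, huZ⟩ : ∃ u ∈ O', G u = κ Z := by rw [hTtgt] at hZT; exact hZT
    have hx : e.symm u ∈ W := hO'W u hu
    have hπx : π (e.symm u) = Z :=
      hκinj _ _ (hsymH _ (hπH ⟨_, hx, rfl⟩)) (hsymH Z hZ) huZ
    have hTu : T.symm (κ Z) = u := by
      rw [← huZ, ← hTapply]; exact T.left_inv (show u ∈ T.source from hu)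
    show f Z = e.symm (T.symm (κ Z))
    rw [hTu, ← hπx, hfπ _ hx]
  refine ⟨O, h, hOo, hZ₀O, ?_, ?_, hfh, ?_⟩
  · -- continuity of `h` on `O`
    refine (e.continuousOn_symm.comp (T.continuousOn_symm.comp κ.continuous.continuousOn fun Z hZ ↦ hZ)
      fun Z hZ ↦ hTsrc_e _ hZ)
  · -- holomorphy of `h` on `O` in affine algebraic coordinates
    intro U s
    have hreg : DifferentiableOn ℂ (evalOrZero (↑U : Y.left.Opens) s ∘ e.symm)
        (e.target ∩ e.symm ⁻¹' {P | P.pt ∈ (↑U : Y.left.Opens)}) :=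
      ((algebraicChart_spec Y n x₁).2 U s).differentiableOn (by simp)
    have hinner : DifferentiableOn ℂ (fun Z ↦ T.symm (κ Z)) O :=
      hTsymm.comp κ.differentiableOn fun Z hZ ↦ hZ
    have hcomp := hreg.comp (hinner.mono (inter_subset_left (t := h ⁻¹' {P | P.pt ∈ (↑U : Y.left.Opens)})))
      (fun Z hZ ↦ ⟨hTsrc_e _ hZ.1, hZ.2⟩)
    exact hcomp
  · -- `f` maps relatively open subsets of `𝔥_g ∩ O` to open sets
    intro B hB
    have hsub : siegelUpperHalfSpace g ∩ O ∩ B ⊆ siegelUpperHalfSpace g ∩ O := inter_subset_left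
    have heq : f '' (siegelUpperHalfSpace g ∩ O ∩ B) = e.symm '' (T.symm '' (κ '' (siegelUpperHalfSpace g ∩ (O ∩ B)))) := by
      rw [inter_assoc, image_image, image_image]
      refine image_congr fun Z hZ ↦ ?_
      exact hfh Z hZ.1 hZ.2.1
    rw [heq]
    have h1 : IsOpen (κ '' (siegelUpperHalfSpace g ∩ (O ∩ B))) := hκopen _ (hOo.inter hB)
    have h1s : κ '' (siegelUpperHalfSpace g ∩ (O ∩ B)) ⊆ T.symm.source := by
      rintro _ ⟨Z, hZ, rfl⟩
      rw [T.symm_source]; exact hZ.2.1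
    have h2 : IsOpen (T.symm '' (κ '' (siegelUpperHalfSpace g ∩ (O ∩ B)))) :=
      T.symm.isOpen_image_of_subset_source h1 h1s
    have h2s : T.symm '' (κ '' (siegelUpperHalfSpace g ∩ (O ∩ B))) ⊆ e.symm.source := by
      rintro _ ⟨v, hv, rfl⟩
      rw [e.symm_source]
      exact hTsrc_e v (by rw [← T.symm_source]; exact h1s hv)
    exact e.symm.isOpen_image_of_subset_source h2 h2s

/-! ### The three analytic clauses -/

/-- **A set-theoretic inverse of injective holomorphic local period maps in equal dimension is continuous on `𝔥_g`,
open on `𝔥_g`, and holomorphic in affine algebraic coordinates.**  `Y` a `ℂ`-scheme locally of finite type and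
smooth of relative dimension `g(g+1)/2`, `f : M_g(ℂ) → Y(ℂ)`; if around every `Z₀ ∈ 𝔥_g` there are an open
`W ⊆ Y(ℂ)` and `π : Y(ℂ) → M_g(ℂ)` continuous and injective on `W`, entrywise holomorphic on `W` in every holomorphic
algebraic chart at points of `W`, with `π(W) ⊆ 𝔥_g`, `Z₀ ∈ π(W)` and `f (π x) = x` on `W`, then `f` is continuous
on `𝔥_g`, `f|_{𝔥_g}` is an open map, and `Z ↦ s(f Z)` is complex-differentiable on `𝔥_g ∩ f⁻¹ U(ℂ)` for every
regular function `s` on every affine open `U ⊆ Y` (Clements–Osgood in Klingen's coordinates `ℂ^{g(g+1)/2}`).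
[cite: FritzscheGrauert2002, Ch. I §8 Thm. 8.5 and Cor. 8.6] [cite: Klingen1990, Ch. I §1 Def. 2 (p. 2)]
[cite: SerreGAGA1956, §2 n°5 Prop. 2] -/
theorem continuousOn_isOpenMap_differentiableOn_of_localInverse
    (H : ∀ Z₀ ∈ siegelUpperHalfSpace g,
      ∃ (W : Set (ComplexPoints Y)) (π : ComplexPoints Y → Matrix (Fin g) (Fin g) ℂ),
        IsOpen W ∧ Z₀ ∈ π '' W ∧ π '' W ⊆ siegelUpperHalfSpace g ∧ InjOn π W ∧ ContinuousOn π W ∧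
        (∀ x ∈ W, ∀ (i j : Fin g),
          DifferentiableOn ℂ ((fun y ↦ π y i j) ∘ (algebraicChart Y (g * (g + 1) / 2) x).symm)
            ((algebraicChart Y (g * (g + 1) / 2) x).target ∩
              (algebraicChart Y (g * (g + 1) / 2) x).symm ⁻¹' W)) ∧
        (∀ x ∈ W, f (π x) = x)) :
    ContinuousOn f (siegelUpperHalfSpace g) ∧
      IsOpenMap ((siegelUpperHalfSpace g).restrict f) ∧
      ∀ (U : Y.left.affineOpens) (s : Y.left.presheaf.obj (Opposite.op (↑U : Y.left.Opens))),
        DifferentiableOn ℂ (fun Z ↦ evalOrZero (↑U : Y.left.Opens) s (f Z))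
          (siegelUpperHalfSpace g ∩ f ⁻¹' {P | P.pt ∈ (↑U : Y.left.Opens)}) := by
  classical
  refine ⟨?_, ?_, ?_⟩
  · -- continuity on `𝔥_g`
    intro Z₀ hZ₀
    obtain ⟨O, h, hOo, hZ₀O, hhc, -, hfh, -⟩ := exists_local_extension Y f (H Z₀ hZ₀)
    have hhZ₀ : ContinuousAt h Z₀ := (hhc Z₀ hZ₀O).continuousAt (hOo.mem_nhds hZ₀O)
    have heq : f =ᶠ[𝓝[siegelUpperHalfSpace g] Z₀] h := by
      filter_upwards [inter_mem_nhdsWithin (siegelUpperHalfSpace g) (hOo.mem_nhds hZ₀O)] with Z hZ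
      exact hfh Z hZ.1 hZ.2
    exact (hhZ₀.continuousWithinAt.congr_of_eventuallyEq heq (hfh Z₀ hZ₀ hZ₀O))
  · -- openness of `f|_{𝔥_g}`
    intro S hS
    obtain ⟨B, hB, rfl⟩ := isOpen_induced_iff.1 hS
    have himg : (siegelUpperHalfSpace g).restrict f '' (Subtype.val ⁻¹' B) = f '' (siegelUpperHalfSpace g ∩ B) := by
      ext y
      constructor
      · rintro ⟨⟨Z, hZH⟩, hZB, rfl⟩
        exact ⟨Z, ⟨hZH, hZB⟩, rfl⟩
      · rintro ⟨Z, ⟨hZH, hZB⟩, rfl⟩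
        exact ⟨⟨Z, hZH⟩, hZB, rfl⟩
    rw [himg, isOpen_iff_forall_mem_open]
    rintro _ ⟨Z, ⟨hZH, hZB⟩, rfl⟩
    obtain ⟨O, h, hOo, hZO, -, -, -, hop⟩ := exists_local_extension Y f (H Z hZH)
    refine ⟨f '' (siegelUpperHalfSpace g ∩ O ∩ B), image_mono fun Z' hZ' ↦ ⟨hZ'.1.1, hZ'.2⟩, hop B hB,
      ⟨Z, ⟨⟨hZH, hZO⟩, hZB⟩, rfl⟩⟩
  · -- holomorphy in affine algebraic coordinates
    intro U s Z ⟨hZH, hZU⟩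
    obtain ⟨O, h, hOo, hZO, hhc, hhol, hfh, -⟩ := exists_local_extension Y f (H Z hZH)
    have hUo : IsOpen {P : ComplexPoints Y | P.pt ∈ (↑U : Y.left.Opens)} :=
      AlgPoints.isOpen_setOf_pt_mem (X := Y) (L := ℂ) (↑U : Y.left.Opens)
    have hO₁ : IsOpen (O ∩ h ⁻¹' {P | P.pt ∈ (↑U : Y.left.Opens)}) := hhc.isOpen_inter_preimage hOo hUo
    have hZO₁ : Z ∈ O ∩ h ⁻¹' {P | P.pt ∈ (↑U : Y.left.Opens)} := by
      refine ⟨hZO, ?_⟩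
      show (h Z).pt ∈ (↑U : Y.left.Opens)
      rw [← hfh Z hZH hZO]; exact hZU
    have hk : DifferentiableAt ℂ (fun Z ↦ evalOrZero (↑U : Y.left.Opens) s (h Z)) Z :=
      (hhol U s Z hZO₁).differentiableAt (hO₁.mem_nhds hZO₁)
    refine hk.differentiableWithinAt.congr_of_eventuallyEq ?_ (by rw [hfh Z hZH hZO])
    filter_upwards [inter_mem_nhdsWithin (siegelUpperHalfSpace g ∩ f ⁻¹' {P | P.pt ∈ (↑U : Y.left.Opens)})
      (hOo.mem_nhds hZO)] with Z' hZ'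
    show evalOrZero (↑U : Y.left.Opens) s (f Z') = evalOrZero (↑U : Y.left.Opens) s (h Z')
    rw [hfh Z' hZ'.1.1 hZ'.2]

end SiegelLocalInverse

/-! ### The specialisation to the complexified Siegel fine moduli scheme (socket «U-e P5») -/

open Literature.AlgebraicGeometry.AbelianSchemes (PolarizedAbelianSchemeWithLevel) in
/-- **U-e P5 (the one place where equidimensionality enters the complex-uniformisation road): for `𝓜_ℂ := 𝓜.M ⊗_ℚ ℂ`
smooth of relative dimension `g(g+1)/2`, a set-theoretic inverse `f : M_g(ℂ) → 𝓜_ℂ(ℂ)` of injective holomorphic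
local period maps is continuous on `𝔥_g`, open on `𝔥_g` and holomorphic in affine algebraic coordinates** — the three
conclusions of the (U)-head's `U_e_siegelClassifyingMap_analytic`, binder for binder the cell's socket
`UHead.Ue_P5_clauses_of_localInverse` (an instance of `continuousOn_isOpenMap_differentiableOn_of_localInverse`).
[cite: FritzscheGrauert2002, Ch. I §8 Thm. 8.5 and Cor. 8.6] [cite: MumfordFogartyKirwan1994, Appendix to Ch. 7 §A (pp. 234–235)] -/
theorem siegelClassifyingMap_clauses_of_localInverse
    (g N : ℕ) (δ : Fin g → ℕ) (_hg : 0 < g) (_hδ : IsPolarizationType δ) (_hN : 3 ≤ N)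
    (𝓜 : SiegelFineModuliScheme g N δ)
    [SmoothOfRelativeDimension (g * (g + 1) / 2) ((Motives.baseChange ℚ ℂ).obj 𝓜.M).hom]
    (f : Matrix (Fin g) (Fin g) ℂ → ComplexPoints ((Motives.baseChange ℚ ℂ).obj 𝓜.M)) :
    haveI : Smooth ((Motives.baseChange ℚ ℂ).obj 𝓜.M).hom := SmoothOfRelativeDimension.smooth (g * (g + 1) / 2) _
    haveI : LocallyOfFiniteType ((Motives.baseChange ℚ ℂ).obj 𝓜.M).hom := inferInstance
    (∀ Z₀ ∈ siegelUpperHalfSpace g,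
      ∃ (W : Set (ComplexPoints ((Motives.baseChange ℚ ℂ).obj 𝓜.M)))
        (π : ComplexPoints ((Motives.baseChange ℚ ℂ).obj 𝓜.M) → Matrix (Fin g) (Fin g) ℂ),
        IsOpen W ∧ Z₀ ∈ π '' W ∧ π '' W ⊆ siegelUpperHalfSpace g ∧ Set.InjOn π W ∧ ContinuousOn π W ∧
        (∀ x ∈ W, ∀ (i j : Fin g),
          DifferentiableOn ℂ
            ((fun y ↦ π y i j) ∘
              (ComplexPoints.algebraicChart ((Motives.baseChange ℚ ℂ).obj 𝓜.M) (g * (g + 1) / 2) x).symm)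
            ((ComplexPoints.algebraicChart ((Motives.baseChange ℚ ℂ).obj 𝓜.M) (g * (g + 1) / 2) x).target ∩
              (ComplexPoints.algebraicChart ((Motives.baseChange ℚ ℂ).obj 𝓜.M) (g * (g + 1) / 2) x).symm ⁻¹' W)) ∧
        (∀ x ∈ W, f (π x) = x)) →
      ContinuousOn f (siegelUpperHalfSpace g) ∧
      IsOpenMap ((siegelUpperHalfSpace g).restrict f) ∧
      ∀ (U : ((Motives.baseChange ℚ ℂ).obj 𝓜.M).left.affineOpens)
        (s : ((Motives.baseChange ℚ ℂ).obj 𝓜.M).left.presheaf.obj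
          (Opposite.op (↑U : ((Motives.baseChange ℚ ℂ).obj 𝓜.M).left.Opens))),
        DifferentiableOn ℂ (fun Z ↦ AlgPoints.evalOrZero (↑U : ((Motives.baseChange ℚ ℂ).obj 𝓜.M).left.Opens) s (f Z))
          (siegelUpperHalfSpace g ∩ f ⁻¹' {P | P.pt ∈ (↑U : ((Motives.baseChange ℚ ℂ).obj 𝓜.M).left.Opens)}) := by
  intro H
  haveI : Smooth ((Motives.baseChange ℚ ℂ).obj 𝓜.M).hom := SmoothOfRelativeDimension.smooth (g * (g + 1) / 2) _
  haveI : LocallyOfFiniteType ((Motives.baseChange ℚ ℂ).obj 𝓜.M).hom := inferInstance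
  exact SiegelLocalInverse.continuousOn_isOpenMap_differentiableOn_of_localInverse _ f H

end Literature.AlgebraicGeometry.ModuliOfAbelianVarieties

end
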